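import Summits.CriticalPhenomena.PercolationContinuityZ3.Theses.PercTreeValue

/-!
# Route `PercTreeValue`, item `AssemblyViaLogConvexity` (stmt-CriticalPhenomena-7805)

`AssemblyViaLogConvexity` says
`ConnectionPatternFactorisation → TetrahedronLogConvexity → PercolationContinuityZ3`
(`θ_{ℤ³}(p_c) = 0`).

Proof (pure limit bookkeeping, the sibling of the route's deciding theorem `closes`): suppose
`θ := θ(p_c) ≠ 0`; `θ` is a probability, so `θ > 0`. With the regular lattice tetrahedron
`T_n = (0, a_n, b_n, c_n)`, `a_n = (n,n,0)`, `b_n = (n,0,n)`, `c_n = (0,n,n)` (all pairwise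
sup-distances equal to `n → ∞`), `ConnectionPatternFactorisation` at `p = p_c` gives

* pattern `{(0,1),(0,2),(0,3)}` on `T_n` (k = 4): `P(0 ↔ a_n ↔ b_n ↔ c_n) → θ⁴`;
* pattern `{(0,1),(0,2)}` on `(0, a_n, b_n)` and on `(0, a_n, c_n)` (k = 3):
  `P(0 ↔ a_n ↔ b_n) → θ³`, `P(0 ↔ a_n ↔ c_n) → θ³`;
* pattern `{(0,1)}` on `(0, a_n)` (k = 2): `τ(0, a_n) → θ²`.

Passing to the limit (`le_of_tendsto_of_tendsto`) in the log-convexity inequality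
`(1+δ) · P(0↔a↔b) · P(0↔a↔c) ≤ P(0↔a↔b↔c) · τ(0,a)` (valid for `r ≥ r₀`) yields
`(1+δ) θ³ θ³ ≤ θ⁴ θ²`, i.e. `δ θ⁶ ≤ 0`, contradicting `δ > 0`, `θ > 0`. Hence `θ(p_c) = 0`, which
is `PercolationContinuityZ3` (`percolationContinuityZ3_iff`).
-/

namespace Summit.CriticalPhenomena.PercolationContinuityZ3.Theorems

open MeasureTheory Filter Literature.Probability.Percolation Literature.Probability.LatticeModels
open Summit.CriticalPhenomena.PercolationContinuityZ3.Theses.PercTreeValue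

/-- **Item `stmt-CriticalPhenomena-7805` (`PercTreeValue.AssemblyViaLogConvexity`), proved.**
`ConnectionPatternFactorisation → TetrahedronLogConvexity → PercolationContinuityZ3`: in a jump
world (`θ(p_c) > 0`) pattern-blindness sends `P(0↔a_n↔b_n↔c_n) → θ⁴`, `P(0↔a_n↔b_n) → θ³`,
`P(0↔a_n↔c_n) → θ³`, `τ(0,a_n) → θ²` along the regular lattice tetrahedra `T_n`, so the uniform
strict log-convexity inequality `(1+δ)·P(0ab)·P(0ac) ≤ P(0abc)·τ(0a)` passes to the limit as
`(1+δ)θ⁶ ≤ θ⁶`, absurd for `δ > 0 < θ`. Hence `θ(p_c) = 0`. [folklore] -/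
theorem percTreeValue_assemblyViaLogConvexity_proof :
    Summit.CriticalPhenomena.PercolationContinuityZ3.Theses.PercTreeValue.AssemblyViaLogConvexity := by
  classical
  unfold Summit.CriticalPhenomena.PercolationContinuityZ3.Theses.PercTreeValue.AssemblyViaLogConvexity
  intro hF hL
  refine Literature.Probability.Percolation.percolationContinuityZ3_iff.mpr ?_
  by_contra hne
  -- θ := θ(p_c) > 0 in the jump world
  have hθnn : 0 ≤ theta (zdGraph 3) (0 : Site 3) (criticalProbI 3) := by
    unfold Literature.Probability.Percolation.theta
    exact measureReal_nonneg
  have hθpos : 0 < theta (zdGraph 3) (0 : Site 3) (criticalProbI 3) :=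
    lt_of_le_of_ne hθnn (Ne.symm hne)
  -- coordinate lower bound ⇒ sup-norm distances tend to ∞
  have key : ∀ (l : Fin 3) (f : ℕ → Site 3),
      (∀ n : ℕ, ‖f n l‖ = (n : ℝ)) → Tendsto (fun n => ‖f n‖) atTop atTop := by
    intro l f hf
    refine tendsto_atTop_mono (fun n => ?_) tendsto_natCast_atTop_atTop
    rw [← hf n]
    exact norm_le_pi_norm (f n) l
  -- the tetrahedron T_n = (0, a_n, b_n, c_n), its two faces through the edge {0, a_n}, and that edge
  let A4 : ℕ → Fin 4 → Site 3 := fun n =>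
    ![(0 : Site 3), ![(n : ℤ), (n : ℤ), 0], ![(n : ℤ), 0, (n : ℤ)], ![0, (n : ℤ), (n : ℤ)]]
  let A3 : ℕ → Fin 3 → Site 3 := fun n =>
    ![(0 : Site 3), ![(n : ℤ), (n : ℤ), 0], ![(n : ℤ), 0, (n : ℤ)]]
  let B3 : ℕ → Fin 3 → Site 3 := fun n =>
    ![(0 : Site 3), ![(n : ℤ), (n : ℤ), 0], ![0, (n : ℤ), (n : ℤ)]]
  let A2 : ℕ → Fin 2 → Site 3 := fun n =>
    ![(0 : Site 3), ![(n : ℤ), (n : ℤ), 0]]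
  have hdist4 : ∀ i j : Fin 4, i ≠ j →
      Tendsto (fun n => ‖A4 n i - A4 n j‖) atTop atTop := by
    intro i j hij
    fin_cases i <;> fin_cases j <;> (first | exact absurd rfl hij | skip) <;>
      first
        | (refine key 0 _ (fun n => ?_); simp [A4]; done)
        | (refine key 1 _ (fun n => ?_); simp [A4])
  have hdist3 : ∀ i j : Fin 3, i ≠ j →
      Tendsto (fun n => ‖A3 n i - A3 n j‖) atTop atTop := by
    intro i j hij
    fin_cases i <;> fin_cases j <;> (first | exact absurd rfl hij | skip) <;>
      first
        | (refine key 0 _ (fun n => ?_); simp [A3]; done)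
        | (refine key 1 _ (fun n => ?_); simp [A3])
  have hdistB : ∀ i j : Fin 3, i ≠ j →
      Tendsto (fun n => ‖B3 n i - B3 n j‖) atTop atTop := by
    intro i j hij
    fin_cases i <;> fin_cases j <;> (first | exact absurd rfl hij | skip) <;>
      first
        | (refine key 0 _ (fun n => ?_); simp [B3]; done)
        | (refine key 1 _ (fun n => ?_); simp [B3])
  have hdist2 : ∀ i j : Fin 2, i ≠ j →
      Tendsto (fun n => ‖A2 n i - A2 n j‖) atTop atTop := by
    intro i j hij
    fin_cases i <;> fin_cases j <;> (first | exact absurd rfl hij | skip) <;>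
      (refine key 0 _ (fun n => ?_); simp [A2])
  -- pattern-blindness limits from ConnectionPatternFactorisation
  have hF' := hF
  unfold ConnectionPatternFactorisation at hF'
  have h4 := hF' (criticalProbI 3) 4 {((0 : Fin 4), (1 : Fin 4)), (0, 2), (0, 3)}
    (by decide) (by decide) A4 hdist4
  have h3a := hF' (criticalProbI 3) 3 {((0 : Fin 3), (1 : Fin 3)), (0, 2)}
    (by decide) (by decide) A3 hdist3
  have h3b := hF' (criticalProbI 3) 3 {((0 : Fin 3), (1 : Fin 3)), (0, 2)}
    (by decide) (by decide) B3 hdistB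
  have h2 := hF' (criticalProbI 3) 2 {((0 : Fin 2), (1 : Fin 2))}
    (by decide) (by decide) A2 hdist2
  have hlim4 : Tendsto (fun r : ℕ =>
      (bondPercolation (zdGraph 3) (criticalProbI 3)).real
        (openConn 0 ![(r : ℤ), (r : ℤ), 0] ∩ openConn 0 ![(r : ℤ), 0, (r : ℤ)] ∩
          openConn 0 ![0, (r : ℤ), (r : ℤ)]))
      atTop (nhds (theta (zdGraph 3) 0 (criticalProbI 3) ^ 4)) := by
    refine Tendsto.congr (fun r => ?_) h4
    simp [A4, Set.inter_assoc]
  have hlim3a : Tendsto (fun r : ℕ =>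
      (bondPercolation (zdGraph 3) (criticalProbI 3)).real
        (openConn 0 ![(r : ℤ), (r : ℤ), 0] ∩ openConn 0 ![(r : ℤ), 0, (r : ℤ)]))
      atTop (nhds (theta (zdGraph 3) 0 (criticalProbI 3) ^ 3)) := by
    refine Tendsto.congr (fun r => ?_) h3a
    simp [A3]
  have hlim3b : Tendsto (fun r : ℕ =>
      (bondPercolation (zdGraph 3) (criticalProbI 3)).real
        (openConn 0 ![(r : ℤ), (r : ℤ), 0] ∩ openConn 0 ![0, (r : ℤ), (r : ℤ)]))
      atTop (nhds (theta (zdGraph 3) 0 (criticalProbI 3) ^ 3)) := by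
    refine Tendsto.congr (fun r => ?_) h3b
    simp [B3]
  have hlim2 : Tendsto (fun r : ℕ => tau 3 (criticalProbI 3) 0 ![(r : ℤ), (r : ℤ), 0])
      atTop (nhds (theta (zdGraph 3) 0 (criticalProbI 3) ^ 2)) := by
    refine Tendsto.congr (fun r => ?_) h2
    simp [A2, Literature.Probability.Percolation.tau_def]
  -- pass to the limit in the strict log-convexity inequality
  have hL' := hL
  unfold TetrahedronLogConvexity at hL'
  obtain ⟨δ, hδ, r₀, hr⟩ := hL'
  have hlimL := ((hlim3a.const_mul (1 + δ)).mul hlim3b)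
  have hlimR := hlim4.mul hlim2
  have hle := le_of_tendsto_of_tendsto hlimL hlimR (eventually_atTop.2 ⟨r₀, fun r hr' => hr r hr'⟩)
  have h6pos := pow_pos hθpos 6
  nlinarith [mul_pos hδ h6pos, hle]

end Summit.CriticalPhenomena.PercolationContinuityZ3.Theorems
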